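/-
Literature/AlgebraicGeometry/Pohlmann1968/CMFieldImprimitiveTypeDegreeLeTwentyTwoHodgeConjecture.lean — pub-hodgecm2 (COR-CM), KEPT Literature lane lit-deligne-3
gen 62, file F62b (+ §5 appended, F62e).  THEOREMS ONLY (no `def`, no named fact, no `sorry`, no instance, no notation; D-0026 net debt 0).  HC_CM is NOT proved.
-/
import Literature.AlgebraicGeometry.Pohlmann1968.GaloisOcticCMFieldAllPowersHodgeConjecture
import HarnessLib

/-!
# Non-primitive CM types of CM fields of degree `≤ 22` — in degree `16` of ABELIAN CM fields —: every realisation (a NON-SIMPLE CM abelian variety of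
# dimension `≤ 11`) has `B•(Aⁿ) ⊗ ℂ = D•(Aⁿ) ⊗ ℂ` and satisfies the Hodge conjecture with all its powers; in particular every non-simple abelian
# variety with complex multiplication by `ℚ(ζ_N)`, `φ(N) ≤ 22`

Layer `Literature/AlgebraicGeometry/Pohlmann1968`, namespace `Literature.AlgebraicGeometry.Pohlmann1968`; sequel of lit-hodgefound's
`CMFieldImprimitiveTypeDegreeLeTwelveHodgeConjecture` (degree `≤ 12`) and `GaloisOcticCMFieldAllPowersHodgeConjecture` (Dodson's Galois octic theorem), written by the
KEPT lane `lit-deligne-3` (gen 62) for its degree-`16` cyclotomic programme (the imprimitive exceptional unit orbits of `ℚ(ζ₄₀)`, `ℚ(ζ₄₈)`, `ℚ(ζ₆₀)`, `ℚ(ζ₃₂)`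
of F61c ∕ F61d ∕ F61e are realised by NON-simple `8`-folds; this file makes every such member, with all its powers, an unconditional case of the Hodge conjecture).

THE ARGUMENT (the one of the degree-`12` file, one step further).  `K` a CM field, `Φ` a NON-primitive CM type, `A ⊨ (K; Φ)`.  The primitive sub-pair
`(K₁, Φ₁)` (Streng Lemma I.3.5, tree `exists_primitive_inducedCMType_eq_of_isCMField`) has `[K : K₁] ≥ 2` (`two_le_finrank_of_not_isPrimitive`), so
`[K₁ : ℚ] ≤ [K : ℚ]/2`; for `[K : ℚ] ≤ 22` this is `≤ 11`, i.e. `≤ 10` (a CM field has even degree).  PRIMITIVE types of CM fields of degree `≤ 10` are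
nondegenerate — degrees `2, 4, 6` by Ribet's bound, `10 = 2·5` by Tankeev–Ribet–Yanai, and degree `8` PROVIDED `K₁/ℚ` IS GALOIS (Dodson 1984 §3.3.2, the Galois
slice; necessary: Mumford–Pohlmann degenerate simple CM fourfolds) — tree `isNondegenerate_of_isPrimitive_of_finrank_le_ten`.  An octic `K₁` with `[K : K₁] ≥ 2`
inside `[K : ℚ] ≤ 22` forces `[K : ℚ] = 16`; so the Galois proviso is void unless `[K : ℚ] = 16`, and it holds when `K/ℚ` is ABELIAN (every intermediate field of
an abelian extension is Galois: Mathlib `IsAbelianGalois.tower_bot`).  Hazama's criterion for induced types (tree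
`IsNondegenerate.hodgeClassSpan_pow_eq_divisorClassesSpan_inducedCMType`) then gives `B•(Aⁿ) ⊗ ℂ = D•(Aⁿ) ⊗ ℂ` for all `n`, and Lefschetz `(1,1)` the Hodge conjecture.

## What is proved

* §1 The engine with the Galois proviso spelled out: `hodgeClassSpan_pow_eq_divisorClassesSpan_of_not_isPrimitive_of_finrank_le_twentyTwo_of_octic_galois`
  (`[K : ℚ] ≤ 22`, every intermediate octic `K₁` with `[K : K₁] ≥ 2` Galois over `ℚ`).
* §2 ANY CM field of degree `≤ 22` other than `16`: **`hodgeClassSpan_pow_eq_divisorClassesSpan_of_not_isPrimitive_of_finrank_le_twentyTwo`**,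
  **`hodgeConjectureFor_pow_of_not_isPrimitive_of_finrank_le_twentyTwo`**, `not_exists_exceptional_pow_of_not_isPrimitive_of_finrank_le_twentyTwo`,
  **`hodgeConjectureFor_pow_of_not_isSimple_of_finrank_le_twentyTwo`** (degrees `14, 18, 20, 22`: non-simple CM abelian `7`-, `9`-, `10`-, `11`-folds, all powers).
* §3 ABELIAN CM fields of degree `≤ 22` (degree `16` included): **`hodgeClassSpan_pow_eq_divisorClassesSpan_of_not_isPrimitive_of_isAbelianGalois`**,
  **`hodgeConjectureFor_pow_of_not_isPrimitive_of_isAbelianGalois`**, `not_exists_exceptional_pow_of_not_isPrimitive_of_isAbelianGalois`,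
  **`hodgeConjectureFor_pow_of_not_isSimple_of_isAbelianGalois`**, `hodgeConjectureFor_of_not_isSimple_of_isAbelianGalois`.
* §4 The cyclotomic fields `ℚ(ζ_N)`, `φ(N) ≤ 22` (so `N ≤ 66`; the six fields of degree `16` are `N = 17, 32, 34, 40, 48, 60`):
  **`hodgeConjectureFor_pow_of_not_isSimple_of_isCyclotomicExtension_of_totient_le`**, `hodgeClassSpan_pow_eq_divisorClassesSpan_of_not_isPrimitive_of_isCyclotomicExtension_of_totient_le`.
  (For `φ(N) ≤ 16` the conclusion is also lit-hodgefound's `hodgeConjectureFor_pow_of_not_isSimple_of_totient_le_sixteen`, `Geometry/Kaehler/CyclotomicDegreeLeSixteenHodgeConjectureComplete`,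
  by per-level censuses; the levels with `φ(N) ∈ {18, 20, 22}` are new.)
* §5 (appended, gen 62) THE SLOT ADAPTER for the tree's family engines (`CMAlgebra.IsNondegenerateFamily.hodgeConjectureFor_of_isIsogenous_prod_inducedCMType`,
  `Pohlmann1968/CMFamilyRankPartition`): **`exists_isNondegenerate_inducedCMType_eq_of_not_isPrimitive_of_isAbelianGalois`** — a non-primitive CM type of an abelian CM field of
  degree `≤ 22` IS induced from a NONDEGENERATE primitive CM type `Φ₁` of a proper CM subfield `K₁` (`[K : K₁] ≥ 2`); the `≠ 16` form for any CM field and the `¬ A.IsSimple` form.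

HONEST REGISTER.  An assembly of tree theorems (nothing here is deeper than Dodson's Galois octic theorem and Yanai's prime theorem, both already in the tree);
unconditional; primitive (simple) types of degree `12–22` can be degenerate and are NOT treated.  HC_CM is NOT proved and not used.

## References

* [Dodson1984] B. Dodson, *The structure of Galois groups of CM-fields*, Trans. AMS 283 (1984) — §3.3.2 Theorem (p. 16). [cite: Dodson1984, §3.3.2 Theorem (p. 16)]
* [Yanai1985] H. Yanai, *On degenerate CM-types*, J. Number Theory 21 (1985) — §4 Theorem (p. 171). [cite: Yanai1985, §4 Theorem (p. 171)]
* [Gordon1999HodgeAVSurvey] B. B. Gordon, *A survey of the Hodge conjecture for abelian varieties* (1999) — Thm. 6.4, 7.5–7.6.1, §9.3. [cite: Gordon1999HodgeAVSurvey, Thm. 6.4 and §9.3]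
* [Streng2010] M. Streng, *Complex multiplication of abelian surfaces*, PhD thesis, Leiden (2010) — Ch. I Def. 3.2, Lemma 3.5. [cite: Streng2010, Ch. I Lemma 3.5]
* [Shimura1998] G. Shimura (1998) — §6.2 Thm. 3, §8.2 Prop. 26. [cite: Shimura1998, §8.2 Prop. 26]

## Provenance

Cell `pub-hodgecm2` (COR-CM), KEPT Literature lane `lit-deligne-3` gen 62 (claim CM-FIELD-IMPRIMITIVE-DEGREE-LE-22; count-neutral, own lane), file F62b.
-/

noncomputable section

open scoped Classical NumberField
open NumberField Module CategoryTheory CategoryTheory.Limits Polynomial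

namespace Literature.AlgebraicGeometry.Pohlmann1968

-- `open scoped`: the tree's action of `Aut(ℂ)` on `Hom(K, ℂ)` by composition (`ringEquivCompAction`) is a scoped instance
open scoped Literature.NumberTheory.ComplexMultiplication
open Literature.AlgebraicGeometry.Motives (CMType AbelianVariety)
open Literature.AlgebraicGeometry.HodgeTheory
open Literature.AlgebraicGeometry.VanGeemen1994 (hodgeClassSpan)
open Literature.Barriers.HodgeConjecture (divisorClassesSpan)
open Literature.NumberTheory.ComplexMultiplication (IsPrimitive inducedCMType exists_primitive_inducedCMType_eq_of_isCMField)
open Literature.AlgebraicGeometry.ComplexMultiplication (IsCMTypeRealisation isPrimitive_ringEquiv_complex_iff isSimple_iff_isPrimitive)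
open Literature.AlgebraicGeometry.ComplexMultiplication.GaloisOcticStabiliser.GaloisOctic (isNondegenerate_of_isPrimitive_of_finrank_le_ten)

variable {K : Type} [Field K] [NumberField K] [IsCMField K]
  {A : AbelianVariety ℂ} {ι : 𝓞 K →+* End A} {θ : K →+* Module.End ℂ (complexBetti A.X 1)}

/-! ## §1 The engine: degree `≤ 22`, octic sub-pairs Galois -/

/-- **`Bᵐ(Aⁿ) ⊗ ℂ = Dᵐ(Aⁿ) ⊗ ℂ` for every realisation of a NON-PRIMITIVE CM type of a CM field of degree `≤ 22` all of whose intermediate octic fields of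
co-degree `≥ 2` are Galois over `ℚ`** (the primitive sub-pair has degree `≤ 10` and is nondegenerate — Ribet, Yanai, and Dodson's Galois octic theorem; then
Hazama's criterion for induced types). [cite: Dodson1984, §3.3.2 Theorem (p. 16)] [cite: Yanai1985, §4 Theorem (p. 171)] [cite: Gordon1999HodgeAVSurvey, Thm. 6.4 and §9.3]
[cite: Streng2010, Ch. I Lemma 3.5] -/
theorem hodgeClassSpan_pow_eq_divisorClassesSpan_of_not_isPrimitive_of_finrank_le_twentyTwo_of_octic_galois (hK : Module.finrank ℚ K ≤ 22)
    (hGal : ∀ K₁ : IntermediateField ℚ K, Module.finrank ℚ K₁ = 8 → 2 ≤ Module.finrank K₁ K → IsGalois ℚ K₁)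
    (Φ : CMType K) (φ₀ : K →+* ℂ) (hΦ : ¬ IsPrimitive (ℂ ≃+* ℂ) Φ.1 φ₀) (hA : IsCMTypeRealisation Φ A ι θ) (n m : ℕ) :
    hodgeClassSpan (⨁ fun _ : Fin n => A).dim (⨁ fun _ : Fin n => A).X m =
      divisorClassesSpan (⨁ fun _ : Fin n => A).X (⨁ fun _ : Fin n => A).dim m := by
  obtain ⟨K₁, Φ₁, hCM, h₁, hp₁, hmin⟩ := exists_primitive_inducedCMType_eq_of_isCMField Φ
  haveI := hCM
  have h2 := two_le_finrank_of_not_isPrimitive hmin φ₀ hΦ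
  have hmul : Module.finrank ℚ K₁ * Module.finrank K₁ K = Module.finrank ℚ K := Module.finrank_mul_finrank ℚ K₁ K
  have hK₁ : Module.finrank ℚ K₁ ≤ 11 := by
    have h : Module.finrank ℚ K₁ * 2 ≤ Module.finrank ℚ K := hmul ▸ Nat.mul_le_mul_left _ h2
    omega
  -- a CM field has even degree, so `[K₁ : ℚ] ≤ 10`
  have heven : Module.finrank ℚ K₁ = Module.finrank ℚ (maximalRealSubfield K₁) * 2 := by
    rw [← Algebra.IsQuadraticExtension.finrank_eq_two (maximalRealSubfield K₁) K₁, Module.finrank_mul_finrank]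
  have hK₁' : Module.finrank ℚ K₁ ≤ 10 := by omega
  obtain ⟨s₀⟩ : Nonempty (K₁ →+* ℂ) := inferInstance
  have hp : IsPrimitive (ℂ ≃+* ℂ) Φ₁.1 s₀ := (isPrimitive_ringEquiv_complex_iff Φ₁ s₀).2 hp₁
  exact (isNondegenerate_of_isPrimitive_of_finrank_le_ten hK₁' (fun h8 => hGal K₁ h8 h2) s₀ hp).hodgeClassSpan_pow_eq_divisorClassesSpan_inducedCMType
    h₁ hA n m

/-- `Bᵐ ⊗ ℂ = Dᵐ ⊗ ℂ` for all `m` on an abelian variety gives the Hodge conjecture for it (Lefschetz `(1,1)`, cup products, tree theorems).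
[cite: Gordon1999HodgeAVSurvey, §9.3] -/
private theorem hodgeConjectureFor_of_forall_hodgeClassSpan_eq₆₂ (B : AbelianVariety ℂ)
    (h : ∀ m : ℕ, hodgeClassSpan B.dim B.X m = divisorClassesSpan B.X B.dim m) : HodgeConjectureFor B.dim B.X :=
  ⟨nonempty_hodgeModel_holds (Motives.AbelianVariety.isSmoothProjective_holds (A := B)),
    fun m _ hc hmm ↦ AbelianVariety.divisorClassesSpan_le_algebraicClasses B
      (fun b hb hb' ↦ lefschetzOneOne_rational_holds (Motives.AbelianVariety.isSmoothProjective_holds (A := B)) b hb hb') m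
      ((h m) ▸ Submodule.subset_span ⟨hc, hmm⟩)⟩

omit [IsCMField K] in
/-- `A ∼ ⨁_{i<1} A` (indeed isomorphic: `biproductUniqueIso`). [folklore] -/
private theorem isIsogenous_biproduct_fin_one₆₂ (B : AbelianVariety ℂ) :
    Motives.AbelianVariety.IsIsogenous B (⨁ fun _ : Fin 1 => B) :=
  let e : B ≅ ⨁ fun _ : Fin 1 => B := (biproductUniqueIso (fun _ : Fin 1 => B)).symm
  ⟨e.hom, Motives.AbelianVariety.isIsogeny_hom_of_iso e⟩

/-! ## §2 Any CM field of degree `≤ 22` other than `16` -/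

omit [IsCMField K] in
/-- Bookkeeping: inside a CM field of degree `≤ 22` and `≠ 16` there is no octic intermediate field of co-degree `≥ 2` (`8·k ≤ 22`, `k ≥ 2 ⟹ 8·k = 16`). [folklore] -/
private theorem octic_galois_vacuous (hK : Module.finrank ℚ K ≤ 22) (h16 : Module.finrank ℚ K ≠ 16) (K₁ : IntermediateField ℚ K)
    (h8 : Module.finrank ℚ K₁ = 8) (h2 : 2 ≤ Module.finrank K₁ K) : IsGalois ℚ K₁ := by
  exfalso
  have hmul : Module.finrank ℚ K₁ * Module.finrank K₁ K = Module.finrank ℚ K := Module.finrank_mul_finrank ℚ K₁ K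
  rw [h8] at hmul
  omega

/-- **`Bᵐ(Aⁿ) ⊗ ℂ = Dᵐ(Aⁿ) ⊗ ℂ` FOR ALL `n, m`, FOR EVERY NON-PRIMITIVE CM TYPE OF A CM FIELD OF DEGREE `≤ 22` AND `≠ 16`, AND EVERY REALISATION** (the primitive
sub-pair has degree `2, 4, 6` or `10`). [cite: Yanai1985, §4 Theorem (p. 171)] [cite: Gordon1999HodgeAVSurvey, Thm. 6.4 and §9.3] [cite: Streng2010, Ch. I Lemma 3.5] -/
theorem hodgeClassSpan_pow_eq_divisorClassesSpan_of_not_isPrimitive_of_finrank_le_twentyTwo (hK : Module.finrank ℚ K ≤ 22) (h16 : Module.finrank ℚ K ≠ 16)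
    (Φ : CMType K) (φ₀ : K →+* ℂ) (hΦ : ¬ IsPrimitive (ℂ ≃+* ℂ) Φ.1 φ₀) (hA : IsCMTypeRealisation Φ A ι θ) (n m : ℕ) :
    hodgeClassSpan (⨁ fun _ : Fin n => A).dim (⨁ fun _ : Fin n => A).X m =
      divisorClassesSpan (⨁ fun _ : Fin n => A).X (⨁ fun _ : Fin n => A).dim m :=
  hodgeClassSpan_pow_eq_divisorClassesSpan_of_not_isPrimitive_of_finrank_le_twentyTwo_of_octic_galois hK (octic_galois_vacuous hK h16) Φ φ₀ hΦ hA n m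

/-- **THE HODGE CONJECTURE FOR EVERY POWER OF EVERY REALISATION OF A NON-PRIMITIVE CM TYPE OF A CM FIELD OF DEGREE `≤ 22`, `≠ 16`.**
[cite: Yanai1985, §4 Theorem (p. 171)] [cite: Gordon1999HodgeAVSurvey, Thm. 6.4 and §9.3] -/
theorem hodgeConjectureFor_pow_of_not_isPrimitive_of_finrank_le_twentyTwo (hK : Module.finrank ℚ K ≤ 22) (h16 : Module.finrank ℚ K ≠ 16) (Φ : CMType K)
    (φ₀ : K →+* ℂ) (hΦ : ¬ IsPrimitive (ℂ ≃+* ℂ) Φ.1 φ₀) (hA : IsCMTypeRealisation Φ A ι θ) (n : ℕ) :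
    HodgeConjectureFor (⨁ fun _ : Fin n => A).dim (⨁ fun _ : Fin n => A).X :=
  hodgeConjectureFor_of_forall_hodgeClassSpan_eq₆₂ _
    (fun m ↦ hodgeClassSpan_pow_eq_divisorClassesSpan_of_not_isPrimitive_of_finrank_le_twentyTwo hK h16 Φ φ₀ hΦ hA n m)

/-- No power of such an `A` carries an exceptional Hodge class. [cite: Gordon1999HodgeAVSurvey, Thm. 6.4] -/
theorem not_exists_exceptional_pow_of_not_isPrimitive_of_finrank_le_twentyTwo (hK : Module.finrank ℚ K ≤ 22) (h16 : Module.finrank ℚ K ≠ 16) (Φ : CMType K)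
    (φ₀ : K →+* ℂ) (hΦ : ¬ IsPrimitive (ℂ ≃+* ℂ) Φ.1 φ₀) (hA : IsCMTypeRealisation Φ A ι θ) (n m : ℕ) :
    ¬ ∃ c : complexBetti (⨁ fun _ : Fin n => A).X (2 * m), IsRationalClass c ∧
        IsOfHodgeType (⨁ fun _ : Fin n => A).dim (⨁ fun _ : Fin n => A).X (2 * m) m m c ∧
        c ∉ divisorClassesSpan (⨁ fun _ : Fin n => A).X (⨁ fun _ : Fin n => A).dim m := by
  rintro ⟨c, hcQ, hcH, hcD⟩
  exact hcD ((hodgeClassSpan_pow_eq_divisorClassesSpan_of_not_isPrimitive_of_finrank_le_twentyTwo hK h16 Φ φ₀ hΦ hA n m) ▸ Submodule.subset_span ⟨hcQ, hcH⟩)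

/-- **THE HODGE CONJECTURE FOR EVERY POWER OF EVERY NON-SIMPLE ABELIAN VARIETY WITH COMPLEX MULTIPLICATION BY A CM FIELD OF DEGREE `14, 18, 20, 22`** (and `≤ 12`):
non-simple CM abelian `7`-, `9`-, `10`-, `11`-folds `A ∼ B^h`, `h ≥ 2`, `B` simple of CM type by a field of degree `2, 4, 6` or `10`.
[cite: Shimura1998, §8.2 Prop. 26] [cite: Yanai1985, §4 Theorem (p. 171)] [cite: Gordon1999HodgeAVSurvey, Thm. 6.4 and §9.3] -/
theorem hodgeConjectureFor_pow_of_not_isSimple_of_finrank_le_twentyTwo (hK : Module.finrank ℚ K ≤ 22) (h16 : Module.finrank ℚ K ≠ 16) (Φ : CMType K)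
    (hA : IsCMTypeRealisation Φ A ι θ) (hns : ¬ A.IsSimple) (n : ℕ) :
    HodgeConjectureFor (⨁ fun _ : Fin n => A).dim (⨁ fun _ : Fin n => A).X := by
  obtain ⟨φ₀⟩ : Nonempty (K →+* ℂ) := inferInstance
  exact hodgeConjectureFor_pow_of_not_isPrimitive_of_finrank_le_twentyTwo hK h16 Φ φ₀ (fun h ↦ hns ((isSimple_iff_isPrimitive hA φ₀).2 h)) hA n

/-! ## §3 Abelian CM fields of degree `≤ 22` (degree `16` included) -/

section Abelian

variable [IsAbelianGalois ℚ K]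

/-- **`Bᵐ(Aⁿ) ⊗ ℂ = Dᵐ(Aⁿ) ⊗ ℂ` FOR ALL `n, m`, FOR EVERY NON-PRIMITIVE CM TYPE OF AN ABELIAN CM FIELD OF DEGREE `≤ 22`, AND EVERY REALISATION** — in degree `16`
the octic sub-pairs are Galois over `ℚ` (sub-extensions of an abelian extension), hence nondegenerate by Dodson's Galois octic theorem.
[cite: Dodson1984, §3.3.2 Theorem (p. 16)] [cite: Yanai1985, §4 Theorem (p. 171)] [cite: Gordon1999HodgeAVSurvey, Thm. 6.4 and §9.3] -/
theorem hodgeClassSpan_pow_eq_divisorClassesSpan_of_not_isPrimitive_of_isAbelianGalois (hK : Module.finrank ℚ K ≤ 22) (Φ : CMType K) (φ₀ : K →+* ℂ)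
    (hΦ : ¬ IsPrimitive (ℂ ≃+* ℂ) Φ.1 φ₀) (hA : IsCMTypeRealisation Φ A ι θ) (n m : ℕ) :
    hodgeClassSpan (⨁ fun _ : Fin n => A).dim (⨁ fun _ : Fin n => A).X m =
      divisorClassesSpan (⨁ fun _ : Fin n => A).X (⨁ fun _ : Fin n => A).dim m :=
  hodgeClassSpan_pow_eq_divisorClassesSpan_of_not_isPrimitive_of_finrank_le_twentyTwo_of_octic_galois hK
    (fun K₁ _ _ => by
      haveI : IsAbelianGalois ℚ K₁ := IsAbelianGalois.tower_bot ℚ K₁ K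
      infer_instance) Φ φ₀ hΦ hA n m

/-- **THE HODGE CONJECTURE FOR EVERY POWER OF EVERY REALISATION OF A NON-PRIMITIVE CM TYPE OF AN ABELIAN CM FIELD OF DEGREE `≤ 22`.**
[cite: Dodson1984, §3.3.2 Theorem (p. 16)] [cite: Gordon1999HodgeAVSurvey, Thm. 6.4 and §9.3] -/
theorem hodgeConjectureFor_pow_of_not_isPrimitive_of_isAbelianGalois (hK : Module.finrank ℚ K ≤ 22) (Φ : CMType K) (φ₀ : K →+* ℂ)
    (hΦ : ¬ IsPrimitive (ℂ ≃+* ℂ) Φ.1 φ₀) (hA : IsCMTypeRealisation Φ A ι θ) (n : ℕ) :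
    HodgeConjectureFor (⨁ fun _ : Fin n => A).dim (⨁ fun _ : Fin n => A).X :=
  hodgeConjectureFor_of_forall_hodgeClassSpan_eq₆₂ _ (fun m ↦ hodgeClassSpan_pow_eq_divisorClassesSpan_of_not_isPrimitive_of_isAbelianGalois hK Φ φ₀ hΦ hA n m)

/-- No power of such an `A` carries an exceptional Hodge class. [cite: Gordon1999HodgeAVSurvey, Thm. 6.4] -/
theorem not_exists_exceptional_pow_of_not_isPrimitive_of_isAbelianGalois (hK : Module.finrank ℚ K ≤ 22) (Φ : CMType K) (φ₀ : K →+* ℂ)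
    (hΦ : ¬ IsPrimitive (ℂ ≃+* ℂ) Φ.1 φ₀) (hA : IsCMTypeRealisation Φ A ι θ) (n m : ℕ) :
    ¬ ∃ c : complexBetti (⨁ fun _ : Fin n => A).X (2 * m), IsRationalClass c ∧
        IsOfHodgeType (⨁ fun _ : Fin n => A).dim (⨁ fun _ : Fin n => A).X (2 * m) m m c ∧
        c ∉ divisorClassesSpan (⨁ fun _ : Fin n => A).X (⨁ fun _ : Fin n => A).dim m := by
  rintro ⟨c, hcQ, hcH, hcD⟩
  exact hcD ((hodgeClassSpan_pow_eq_divisorClassesSpan_of_not_isPrimitive_of_isAbelianGalois hK Φ φ₀ hΦ hA n m) ▸ Submodule.subset_span ⟨hcQ, hcH⟩)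

/-- **THE HODGE CONJECTURE FOR EVERY POWER OF EVERY NON-SIMPLE ABELIAN VARIETY WITH COMPLEX MULTIPLICATION BY AN ABELIAN CM FIELD OF DEGREE `≤ 22`** — in particular for
the non-simple abelian `8`-folds with complex multiplication by the abelian CM fields of degree `16`.
[cite: Shimura1998, §8.2 Prop. 26] [cite: Dodson1984, §3.3.2 Theorem (p. 16)] [cite: Gordon1999HodgeAVSurvey, Thm. 6.4 and §9.3] -/
theorem hodgeConjectureFor_pow_of_not_isSimple_of_isAbelianGalois (hK : Module.finrank ℚ K ≤ 22) (Φ : CMType K) (hA : IsCMTypeRealisation Φ A ι θ)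
    (hns : ¬ A.IsSimple) (n : ℕ) : HodgeConjectureFor (⨁ fun _ : Fin n => A).dim (⨁ fun _ : Fin n => A).X := by
  obtain ⟨φ₀⟩ : Nonempty (K →+* ℂ) := inferInstance
  exact hodgeConjectureFor_pow_of_not_isPrimitive_of_isAbelianGalois hK Φ φ₀ (fun h ↦ hns ((isSimple_iff_isPrimitive hA φ₀).2 h)) hA n

/-- `A` itself (spelling `A.dim`, `A.X`). [cite: Dodson1984, §3.3.2 Theorem (p. 16)] [cite: Gordon1999HodgeAVSurvey, Thm. 6.4 and §9.3] -/
theorem hodgeConjectureFor_of_not_isSimple_of_isAbelianGalois (hK : Module.finrank ℚ K ≤ 22) (Φ : CMType K) (hA : IsCMTypeRealisation Φ A ι θ)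
    (hns : ¬ A.IsSimple) : HodgeConjectureFor A.dim A.X :=
  HodgeConjectureFor.of_isIsogenous (isIsogenous_biproduct_fin_one₆₂ A) (hodgeConjectureFor_pow_of_not_isSimple_of_isAbelianGalois hK Φ hA hns 1)

end Abelian

/-! ## §4 The cyclotomic fields `ℚ(ζ_N)`, `φ(N) ≤ 22` -/

section Cyclotomic

variable {N : ℕ} [NeZero N] [IsCyclotomicExtension {N} ℚ K]

omit [IsCMField K] in
include N in
/-- `[ℚ(ζ_N) : ℚ] = φ(N)`. [folklore] -/
private theorem finrank_le_of_totient_le {b : ℕ} (hN : Nat.totient N ≤ b) : Module.finrank ℚ K ≤ b := by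
  rw [IsCyclotomicExtension.finrank K (cyclotomic.irreducible_rat (NeZero.pos N))]; exact hN

include N in
/-- **`Bᵐ(Aⁿ) ⊗ ℂ = Dᵐ(Aⁿ) ⊗ ℂ` for every realisation of a NON-PRIMITIVE CM type of `ℚ(ζ_N)`, `φ(N) ≤ 22`** (`ℚ(ζ_N)/ℚ` is abelian).
[cite: Dodson1984, §3.3.2 Theorem (p. 16)] [cite: Gordon1999HodgeAVSurvey, Thm. 6.4 and §9.3] -/
theorem hodgeClassSpan_pow_eq_divisorClassesSpan_of_not_isPrimitive_of_isCyclotomicExtension_of_totient_le (hN : Nat.totient N ≤ 22) (Φ : CMType K)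
    (φ₀ : K →+* ℂ) (hΦ : ¬ IsPrimitive (ℂ ≃+* ℂ) Φ.1 φ₀) (hA : IsCMTypeRealisation Φ A ι θ) (n m : ℕ) :
    hodgeClassSpan (⨁ fun _ : Fin n => A).dim (⨁ fun _ : Fin n => A).X m =
      divisorClassesSpan (⨁ fun _ : Fin n => A).X (⨁ fun _ : Fin n => A).dim m := by
  haveI : IsAbelianGalois ℚ K := IsCyclotomicExtension.isAbelianGalois {N} ℚ K
  exact hodgeClassSpan_pow_eq_divisorClassesSpan_of_not_isPrimitive_of_isAbelianGalois (finrank_le_of_totient_le (K := K) (N := N) hN) Φ φ₀ hΦ hA n m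

include N in
/-- **THE HODGE CONJECTURE FOR EVERY POWER OF EVERY NON-SIMPLE ABELIAN VARIETY WITH COMPLEX MULTIPLICATION BY `ℚ(ζ_N)`, `φ(N) ≤ 22`** — in particular for the
non-simple `8`-folds of the six cyclotomic fields of degree `16` (`N = 17, 32, 34, 40, 48, 60`). [cite: Dodson1984, §3.3.2 Theorem (p. 16)] [cite: Gordon1999HodgeAVSurvey, Thm. 6.4 and §9.3] -/
theorem hodgeConjectureFor_pow_of_not_isSimple_of_isCyclotomicExtension_of_totient_le (hN : Nat.totient N ≤ 22) (Φ : CMType K)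
    (hA : IsCMTypeRealisation Φ A ι θ) (hns : ¬ A.IsSimple) (n : ℕ) : HodgeConjectureFor (⨁ fun _ : Fin n => A).dim (⨁ fun _ : Fin n => A).X := by
  haveI : IsAbelianGalois ℚ K := IsCyclotomicExtension.isAbelianGalois {N} ℚ K
  exact hodgeConjectureFor_pow_of_not_isSimple_of_isAbelianGalois (finrank_le_of_totient_le (K := K) (N := N) hN) Φ hA hns n

include N in
/-- `A` itself. [cite: Dodson1984, §3.3.2 Theorem (p. 16)] [cite: Gordon1999HodgeAVSurvey, Thm. 6.4 and §9.3] -/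
theorem hodgeConjectureFor_of_not_isSimple_of_isCyclotomicExtension_of_totient_le (hN : Nat.totient N ≤ 22) (Φ : CMType K)
    (hA : IsCMTypeRealisation Φ A ι θ) (hns : ¬ A.IsSimple) : HodgeConjectureFor A.dim A.X := by
  haveI : IsAbelianGalois ℚ K := IsCyclotomicExtension.isAbelianGalois {N} ℚ K
  exact hodgeConjectureFor_of_not_isSimple_of_isAbelianGalois (finrank_le_of_totient_le (K := K) (N := N) hN) Φ hA hns

end Cyclotomic

/-! ## §5 The nondegenerate primitive core of a non-primitive type (slot adapter for the family engines) -/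

/-- **THE NONDEGENERATE CORE, with the Galois proviso spelled out**: a NON-PRIMITIVE CM type `Φ` of a CM field `K` of degree `≤ 22`, all of whose intermediate octic fields of co-degree
`≥ 2` are Galois over `ℚ`, is induced from a PRIMITIVE and NONDEGENERATE CM type `Φ₁` of a proper CM subfield `K₁` (`[K : K₁] ≥ 2`; Streng Lemma I.3.5 for the sub-pair, Ribet ∕
Yanai ∕ Dodson for its nondegeneracy).  This is the datum the tree's family engines consume (`CMAlgebra.IsNondegenerateFamily.…_inducedCMType`, `CMFamilyRankPartition`).
[cite: Streng2010, Ch. I Lemma 3.5] [cite: Dodson1984, §3.3.2 Theorem (p. 16)] [cite: Yanai1985, §4 Theorem (p. 171)] -/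
theorem exists_isNondegenerate_inducedCMType_eq_of_not_isPrimitive_of_finrank_le_twentyTwo_of_octic_galois (hK : Module.finrank ℚ K ≤ 22)
    (hGal : ∀ K₁ : IntermediateField ℚ K, Module.finrank ℚ K₁ = 8 → 2 ≤ Module.finrank K₁ K → IsGalois ℚ K₁)
    (Φ : CMType K) (φ₀ : K →+* ℂ) (hΦ : ¬ IsPrimitive (ℂ ≃+* ℂ) Φ.1 φ₀) :
    ∃ (K₁ : IntermediateField ℚ K) (Φ₁ : CMType K₁), IsCMField K₁ ∧ IsNondegenerate Φ₁ ∧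
      inducedCMType (algebraMap K₁ K) Φ₁ = Φ ∧
      (∀ s t : K₁ →+* ℂ, (∀ τ : ℂ ≃+* ℂ, (τ : ℂ →+* ℂ).comp s ∈ Φ₁.1 ↔ (τ : ℂ →+* ℂ).comp t ∈ Φ₁.1) → s = t) ∧
      2 ≤ Module.finrank K₁ K ∧ Module.finrank ℚ K₁ ≤ 10 := by
  obtain ⟨K₁, Φ₁, hCM, h₁, hp₁, hmin⟩ := exists_primitive_inducedCMType_eq_of_isCMField Φ
  haveI := hCM
  have h2 := two_le_finrank_of_not_isPrimitive hmin φ₀ hΦ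
  have hmul : Module.finrank ℚ K₁ * Module.finrank K₁ K = Module.finrank ℚ K := Module.finrank_mul_finrank ℚ K₁ K
  have hK₁ : Module.finrank ℚ K₁ ≤ 11 := by
    have h : Module.finrank ℚ K₁ * 2 ≤ Module.finrank ℚ K := hmul ▸ Nat.mul_le_mul_left _ h2
    omega
  have heven : Module.finrank ℚ K₁ = Module.finrank ℚ (maximalRealSubfield K₁) * 2 := by
    rw [← Algebra.IsQuadraticExtension.finrank_eq_two (maximalRealSubfield K₁) K₁, Module.finrank_mul_finrank]
  have hK₁' : Module.finrank ℚ K₁ ≤ 10 := by omega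
  obtain ⟨s₀⟩ : Nonempty (K₁ →+* ℂ) := inferInstance
  have hp : IsPrimitive (ℂ ≃+* ℂ) Φ₁.1 s₀ := (isPrimitive_ringEquiv_complex_iff Φ₁ s₀).2 hp₁
  exact ⟨K₁, Φ₁, hCM, isNondegenerate_of_isPrimitive_of_finrank_le_ten hK₁' (fun h8 => hGal K₁ h8 h2) s₀ hp, h₁, hp₁, h2, hK₁'⟩

/-- **The nondegenerate core, any CM field of degree `≤ 22` other than `16`.** [cite: Streng2010, Ch. I Lemma 3.5] [cite: Yanai1985, §4 Theorem (p. 171)] -/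
theorem exists_isNondegenerate_inducedCMType_eq_of_not_isPrimitive_of_finrank_le_twentyTwo (hK : Module.finrank ℚ K ≤ 22) (h16 : Module.finrank ℚ K ≠ 16)
    (Φ : CMType K) (φ₀ : K →+* ℂ) (hΦ : ¬ IsPrimitive (ℂ ≃+* ℂ) Φ.1 φ₀) :
    ∃ (K₁ : IntermediateField ℚ K) (Φ₁ : CMType K₁), IsCMField K₁ ∧ IsNondegenerate Φ₁ ∧
      inducedCMType (algebraMap K₁ K) Φ₁ = Φ ∧
      (∀ s t : K₁ →+* ℂ, (∀ τ : ℂ ≃+* ℂ, (τ : ℂ →+* ℂ).comp s ∈ Φ₁.1 ↔ (τ : ℂ →+* ℂ).comp t ∈ Φ₁.1) → s = t) ∧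
      2 ≤ Module.finrank K₁ K ∧ Module.finrank ℚ K₁ ≤ 10 :=
  exists_isNondegenerate_inducedCMType_eq_of_not_isPrimitive_of_finrank_le_twentyTwo_of_octic_galois hK (octic_galois_vacuous hK h16) Φ φ₀ hΦ

/-- **The nondegenerate core, ABELIAN CM fields of degree `≤ 22`** (degree `16` included: the octic sub-pairs are Galois, Dodson).
[cite: Streng2010, Ch. I Lemma 3.5] [cite: Dodson1984, §3.3.2 Theorem (p. 16)] -/
theorem exists_isNondegenerate_inducedCMType_eq_of_not_isPrimitive_of_isAbelianGalois [IsAbelianGalois ℚ K] (hK : Module.finrank ℚ K ≤ 22) (Φ : CMType K)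
    (φ₀ : K →+* ℂ) (hΦ : ¬ IsPrimitive (ℂ ≃+* ℂ) Φ.1 φ₀) :
    ∃ (K₁ : IntermediateField ℚ K) (Φ₁ : CMType K₁), IsCMField K₁ ∧ IsNondegenerate Φ₁ ∧
      inducedCMType (algebraMap K₁ K) Φ₁ = Φ ∧
      (∀ s t : K₁ →+* ℂ, (∀ τ : ℂ ≃+* ℂ, (τ : ℂ →+* ℂ).comp s ∈ Φ₁.1 ↔ (τ : ℂ →+* ℂ).comp t ∈ Φ₁.1) → s = t) ∧
      2 ≤ Module.finrank K₁ K ∧ Module.finrank ℚ K₁ ≤ 10 :=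
  exists_isNondegenerate_inducedCMType_eq_of_not_isPrimitive_of_finrank_le_twentyTwo_of_octic_galois hK
    (fun K₁ _ _ => by
      haveI : IsAbelianGalois ℚ K₁ := IsAbelianGalois.tower_bot ℚ K₁ K
      infer_instance) Φ φ₀ hΦ

/-- **The nondegenerate core of the type of a NON-SIMPLE realisation** (`A ⊨ (K; Φ)` not simple ⟺ `Φ` not primitive, Shimura §8.2 Prop. 26), abelian `K` of degree `≤ 22`.
[cite: Shimura1998, §8.2 Prop. 26] [cite: Streng2010, Ch. I Lemma 3.5] [cite: Dodson1984, §3.3.2 Theorem (p. 16)] -/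
theorem exists_isNondegenerate_inducedCMType_eq_of_not_isSimple_of_isAbelianGalois [IsAbelianGalois ℚ K] (hK : Module.finrank ℚ K ≤ 22) (Φ : CMType K)
    (hA : IsCMTypeRealisation Φ A ι θ) (hns : ¬ A.IsSimple) :
    ∃ (K₁ : IntermediateField ℚ K) (Φ₁ : CMType K₁), IsCMField K₁ ∧ IsNondegenerate Φ₁ ∧
      inducedCMType (algebraMap K₁ K) Φ₁ = Φ ∧
      (∀ s t : K₁ →+* ℂ, (∀ τ : ℂ ≃+* ℂ, (τ : ℂ →+* ℂ).comp s ∈ Φ₁.1 ↔ (τ : ℂ →+* ℂ).comp t ∈ Φ₁.1) → s = t) ∧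
      2 ≤ Module.finrank K₁ K ∧ Module.finrank ℚ K₁ ≤ 10 := by
  obtain ⟨φ₀⟩ : Nonempty (K →+* ℂ) := inferInstance
  exact exists_isNondegenerate_inducedCMType_eq_of_not_isPrimitive_of_isAbelianGalois hK Φ φ₀ (fun h ↦ hns ((isSimple_iff_isPrimitive hA φ₀).2 h))

end Literature.AlgebraicGeometry.Pohlmann1968

end
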